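import Literature.NumberTheory.Automorphic.LevelActionNormalizingHeckeComm
import Literature.NumberTheory.Automorphic.SymCoeffLattice
import Literature.NumberTheory.Automorphic.HidaLevelDiamondAction
import Literature.NumberTheory.Automorphic.IwahoriUpCrossPlace
import Literature.NumberTheory.Automorphic.PadicEmbeddingCoefficientRing
import HarnessLib

/-!
# Diamond operators on `H^i(U(b,c), ⨂_τ Sym^{k−2}(𝒪²))` (coefficients-at-`p` model)

Topic `NumberTheory/Automorphic`; namespaces `Literature.NumberTheory.Automorphic.BigHeckeGLn`
(group theory) and `…ParallelWeight` (the action); definitions with bodies and theorems.  The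
diamond-operator structure of Hida theory on the `p`-ADIC lattice cohomology of the levels
`U(b,c)` of a tame level `𝒰` maximal above `p` ([Hida1994AIF, §2: the action of `G`];
[KhareThorne2017, §6.3: "`H^*(X_{U(b,c)}, ·)` is a module over `𝒪[T(1)/T(b)]`"]), instantiating
`LevelActionNormalizingHecke(Comm)` with the torus `T(1) = ∏_{v ∣ p} T_2(𝒪_v)` acting through
`diamondPi` (`HidaLevelDiamondAction`):

* `commute_diamondPi_heckeElement_pow`, `commute_diamondPi_upElement` — diamonds commute with the
  `U_p`-elements `t_{w,1}^r` and `∏_w t_{w,1}^r`;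
* `level_le_integralMonoid`, `diamondPi_mem_integralMonoid` — the level and the diamonds lie in the
  integral monoid of the chosen `p`-adic places;
* **`latticeDiamond 𝒰 h𝒰 b c i : T(1) →* End_𝒪 H^i(U(b,c), ⨂_τ Sym^{k−2}(𝒪²))`**, `u ↦ ⟨u⟩`, a
  monoid homomorphism **trivial on `T(b)`** (`latticeDiamond_eq_one_of_mem`), **commuting with every
  `[U α U]` for `α` commuting with the diamonds** (`latticeDiamond_comm_heckeCohomology`; e.g.
  `α = ∏_w t_{w,1}^r`) and hence **preserving the `[U α U]`-ordinary part**
  (`mapsTo_latticeDiamond_ordinaryPart`).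

## References

* H. Hida, Ann. Inst. Fourier 44 (1994), §2 (held). [Hida1994AIF]
* C. Khare, J. A. Thorne, Amer. J. Math. 139 (2017), §6.3 (arXiv:1409.7007, held). [KhareThorne2017]
-/

noncomputable section

open CategoryTheory IsDedekindDomain NumberField

namespace Literature.NumberTheory.Automorphic

namespace BigHeckeGLn

variable {K : Type} [Field K] [NumberField K] (p : ℕ) [Fact p.Prime]

/-- A diamond element commutes with the `U_p`-elements `t_{w,1}^r`. [folklore] -/
theorem commute_diamondElement_heckeElement_pow (v w : HeightOneSpectrum (𝓞 K))
    (u : Fin 2 → (v.adicCompletionIntegers K)ˣ) (r : ℕ) :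
    Commute (diamondElement 2 K v u) (heckeElement 2 K w 1 ^ r) := by
  rw [heckeElement_one_pow_eq_ofLocal w r]
  by_cases hvw : w = v
  · subst hvw
    rw [diamondElement_apply, cutDiag]
    unfold Commute SemiconjBy
    rw [← map_mul, ← map_mul, ← map_mul, ← map_mul, mul_comm]
  · exact mul_ofLocal_comm (by rw [diamondElement_apply, localComponent_ofLocal_of_ne hvw]) _

/-- `diamondPi u` commutes with `t_{w,1}^r`. [folklore] -/
theorem commute_diamondPi_heckeElement_pow (u : ∀ v : PlacesAbove K p, (Fin 2 → (v.1.adicCompletionIntegers K)ˣ))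
    (w : HeightOneSpectrum (𝓞 K)) (r : ℕ) :
    Commute (diamondPi 2 K p u) (heckeElement 2 K w 1 ^ r) := by
  classical
  rw [diamondPi, MonoidHom.noncommPiCoprod_apply]
  exact (Finset.noncommProd_commute Finset.univ (fun v : PlacesAbove K p => diamondElement 2 K v.1 (u v)) _
    (heckeElement 2 K w 1 ^ r) fun v _ => (commute_diamondElement_heckeElement_pow v.1 w (u v) r).symm).symm

/-- `diamondPi u` commutes with `∏_{w ∈ s} t_{w,1}^r`. [folklore] -/
theorem commute_diamondPi_upElement (u : ∀ v : PlacesAbove K p, (Fin 2 → (v.1.adicCompletionIntegers K)ˣ))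
    (s : Finset (HeightOneSpectrum (𝓞 K))) (r : ℕ) :
    Commute (diamondPi 2 K p u) (TameLevel.upElement s r) :=
  Finset.noncommProd_commute s (fun v => heckeElement 2 K v 1 ^ r) _ (diamondPi 2 K p u) fun w _ =>
    commute_diamondPi_heckeElement_pow p u w r

end BigHeckeGLn

namespace ParallelWeight

open BigHeckeGLn IntegralWeightGL2 LevelAction

variable (F : Type) [Field F] [NumberField F] (k : ℕ) (p : ℕ) [Fact p.Prime] (𝒰 : TameLevel 2 F p)

/-- **`U(b,c)` lies in the integral monoid** of the chosen `p`-adic places. [folklore] -/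
theorem level_le_integralMonoid (b c : ℕ) :
    (𝒰.level b c).toSubmonoid ≤ integralMonoid F (padicPlace F p) := fun u hu =>
  (mem_integralMonoid_iff u).2 fun τ i j => by
    have hloc := ((𝒰.mem_level_iff b c u).1 hu).2 (padicPlace F p τ) (natCast_mem_padicPlace F p τ)
    exact (HeightOneSpectrum.mem_adicCompletionIntegers (R := 𝓞 F) F _).2
      ((mem_valuedIwahoriSubgroup_iff.1 hloc).1.le_one i j)

/-- **The diamonds lie in the integral monoid.** [folklore] -/
theorem diamondPi_mem_integralMonoid (u : ∀ v : PlacesAbove F p, (Fin 2 → (v.1.adicCompletionIntegers F)ˣ)) :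
    diamondPi 2 F p u ∈ integralMonoid F (padicPlace F p) :=
  (mem_integralMonoid_iff _).2 fun τ i j => by
    rw [localComponent_diamondPi u ⟨padicPlace F p τ, natCast_mem_padicPlace F p τ⟩, coe_glDiagonal,
      Matrix.diagonal_apply]
    split_ifs
    · exact SetLike.coe_mem _
    · exact Subring.zero_mem _

variable {𝒰}

variable (𝒰) in
/-- The Hecke operator `[U(b,c) α U(b,c)]` on `H^i(U(b,c), ⨂_τ Sym^{k−2}(𝒪²))` for `α` in the integral
monoid (abbreviation). [folklore] -/
abbrev latticeHecke (b c i : ℕ) {α : FiniteAdelicGL 2 F} (hα : α ∈ integralMonoid F (padicPlace F p)) :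
    Module.End (padicEmbInt F p)
      (LevelAction.cohomology (globalEmbedding 2 F) (integralMonoid F (padicPlace F p))
        (symLatticeAction (padicEmbInt F p) (PadicAlgCl p) F k (padicPlace F p) (padicEmbIntHom F p))
        (𝒰.level b c) i) :=
  heckeCohomology (globalEmbedding 2 F) (integralMonoid F (padicPlace F p))
    (symLatticeAction (padicEmbInt F p) (PadicAlgCl p) F k (padicPlace F p) (padicEmbIntHom F p)) (𝒰.level b c)
    (level_le_integralMonoid F p 𝒰 b c) hα i

/-- Diamonds conjugate `U(b,c)` into itself (one way). [folklore] -/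
theorem diamondPi_normalizing (h𝒰 : 𝒰.IsMaximalAbove) (b c : ℕ)
    (u : ∀ v : PlacesAbove F p, (Fin 2 → (v.1.adicCompletionIntegers F)ˣ))
    (x : FiniteAdelicGL 2 F) (hx : x ∈ 𝒰.level b c) :
    (diamondPi 2 F p u)⁻¹ * x * diamondPi 2 F p u ∈ 𝒰.level b c :=
  𝒰.diamondPi_conj_mem_level h𝒰 b c u hx

/-- Diamonds conjugate `U(b,c)` into itself (the other way). [folklore] -/
theorem diamondPi_normalizing' (h𝒰 : 𝒰.IsMaximalAbove) (b c : ℕ)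
    (u : ∀ v : PlacesAbove F p, (Fin 2 → (v.1.adicCompletionIntegers F)ˣ))
    (x : FiniteAdelicGL 2 F) (hx : x ∈ 𝒰.level b c) :
    diamondPi 2 F p u * x * (diamondPi 2 F p u)⁻¹ ∈ 𝒰.level b c := by
  have h := 𝒰.diamondPi_conj_mem_level h𝒰 b c u⁻¹ hx
  rwa [map_inv, inv_inv] at h

/-- **The diamond operators `u ↦ ⟨u⟩ = [U(b,c) diag(u)_p U(b,c)]` on
`H^i(U(b,c), ⨂_τ Sym^{k−2}(𝒪²))`**, a monoid homomorphism from `T(1) = ∏_{v ∣ p} T_2(𝒪_v)`.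
[cite: Hida1994AIF, §2] [cite: KhareThorne2017, §6.3] -/
def latticeDiamond (h𝒰 : 𝒰.IsMaximalAbove) (b c i : ℕ) :
    (∀ v : PlacesAbove F p, (Fin 2 → (v.1.adicCompletionIntegers F)ˣ)) →*
      Module.End (padicEmbInt F p)
        (LevelAction.cohomology (globalEmbedding 2 F) (integralMonoid F (padicPlace F p))
          (symLatticeAction (padicEmbInt F p) (PadicAlgCl p) F k (padicPlace F p) (padicEmbIntHom F p))
          (𝒰.level b c) i) :=
  normalizingAction (globalEmbedding 2 F) (integralMonoid F (padicPlace F p))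
    (symLatticeAction (padicEmbInt F p) (PadicAlgCl p) F k (padicPlace F p) (padicEmbIntHom F p)) (𝒰.level b c)
    (level_le_integralMonoid F p 𝒰 b c) (diamondPi 2 F p) (diamondPi_mem_integralMonoid F p)
    (fun u x hx => diamondPi_normalizing F p h𝒰 b c u x hx) i

/-- Unfolding `latticeDiamond`: `⟨u⟩ = [U diamondPi(u) U]`. [folklore] -/
theorem latticeDiamond_apply (h𝒰 : 𝒰.IsMaximalAbove) (b c i : ℕ) (u : ∀ v : PlacesAbove F p, (Fin 2 → (v.1.adicCompletionIntegers F)ˣ)) :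
    latticeDiamond F k p h𝒰 b c i u = latticeHecke F k p 𝒰 b c i (diamondPi_mem_integralMonoid F p u) :=
  rfl

/-- **`⟨u⟩ = 1` for `u ∈ T(b) = ∏_v T_v(b)`**: the diamond action factors through `T(1)/T(b)`.
[cite: KhareThorne2017, §6.3] -/
theorem latticeDiamond_eq_one_of_mem (h𝒰 : 𝒰.IsMaximalAbove) (b c i : ℕ)
    {u : ∀ v : PlacesAbove F p, (Fin 2 → (v.1.adicCompletionIntegers F)ˣ)}
    (hu : ∀ v, u v ∈ torusBall v.1 b) : latticeDiamond F k p h𝒰 b c i u = 1 :=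
  normalizingAction_eq_one_of_mem _ _ _ _ _ _ _ _ i (𝒰.diamondPi_mem_level h𝒰 c u hu)

/-- **The diamonds commute with `[U α U]` for `α` in the integral monoid commuting with them** (e.g.
`α = ∏_w t_{w,1}^r`, `commute_diamondPi_upElement`). [cite: KhareThorne2017, §6.3] -/
theorem latticeDiamond_comm_heckeCohomology (h𝒰 : 𝒰.IsMaximalAbove) (b c i : ℕ) {α : FiniteAdelicGL 2 F} (hα : α ∈ integralMonoid F (padicPlace F p))
    (hc : ∀ u, Commute (diamondPi 2 F p u) α) (u : ∀ v : PlacesAbove F p, (Fin 2 → (v.1.adicCompletionIntegers F)ˣ)) :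
    latticeDiamond F k p h𝒰 b c i u * latticeHecke F k p 𝒰 b c i hα =
      latticeHecke F k p 𝒰 b c i hα * latticeDiamond F k p h𝒰 b c i u :=
  heckeCohomology_comm_of_normalizing _ _ _ _ _ (diamondPi_mem_integralMonoid F p u) hα
    (fun x hx => diamondPi_normalizing F p h𝒰 b c u x hx) (fun x hx => diamondPi_normalizing' F p h𝒰 b c u x hx)
    (hc u).eq i

/-- **The diamonds preserve the `[U α U]`-ordinary part** `⋂ₙ range [UαU]ⁿ` (`α` as above).
[cite: KhareThorne2017, §6.3] -/
theorem mapsTo_latticeDiamond_ordinaryPart (h𝒰 : 𝒰.IsMaximalAbove) (b c i : ℕ) {α : FiniteAdelicGL 2 F} (hα : α ∈ integralMonoid F (padicPlace F p))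
    (hc : ∀ u, Commute (diamondPi 2 F p u) α) (u : ∀ v : PlacesAbove F p, (Fin 2 → (v.1.adicCompletionIntegers F)ˣ)) :
    Set.MapsTo (latticeDiamond F k p h𝒰 b c i u)
      (⨅ n : ℕ, LinearMap.range (latticeHecke F k p 𝒰 b c i hα ^ n) : Submodule (padicEmbInt F p) _)
      (⨅ n : ℕ, LinearMap.range (latticeHecke F k p 𝒰 b c i hα ^ n) : Submodule (padicEmbInt F p) _) :=
  mapsTo_normalizing_ordinaryPart _ _ _ _ _ (diamondPi_mem_integralMonoid F p u) hα
    (fun x hx => diamondPi_normalizing F p h𝒰 b c u x hx) (fun x hx => diamondPi_normalizing' F p h𝒰 b c u x hx)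
    (hc u).eq i

end ParallelWeight

end Literature.NumberTheory.Automorphic
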